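import Mathlib

/-!
# Subfield cell `GL₂(𝔽₉) ⊃ SL₂(𝔽₃)` at level one — I: the λ-layer tables

**Honest framing.** VALUE = a kernel-checked finite certificate about ONE finite cell of
ONE skeleton line (`quadratic_extension_level_one_cell`, stub S3 `stub_subfieldCell`, crux
`GradedDesignFamily` of route `LevelGradedCohnUmans`), in the *standard model*
`(k, K, φ) = (𝔽₃, 𝔽₉, mapGL)`.  It is **not** progress on `Summit.MatrixMultiplication` (no bound on
`ω` is touched) and it does **not** refute `stub_subfieldCell`, whose quantifiers
`∃ c > 0, ∀ N, ∃ (k, K, φ) …` are insensitive to any single cell.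

## Content of this file (definitions + decidable facts)

Conventions are those of the positive witnesses `subfieldCell_nine_witness*`:
`K = 𝔽₉ = QuadraticAlgebra (ZMod 3) (-1) 0`, `H = SL₂(𝔽₃)` embedded entrywise (`phiM`, which is
`Matrix.SpecialLinearGroup.mapGL K` by `phiM_eq`).

* The **λ-layer** of `H`: `kexp h ∈ ℤ/3` is the class of `h` modulo the quaternion subgroup
  `Q₈ = {h | h⁴ = 1}` (measured against the transvection `tU`), and `cval e = 2ω^e ∈ ℤ[√-3]`
  (`ω = (-1+√-3)/2`); `Mfun x v = Σ_{h : h•x = v} cval (kexp h)`.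
* The 80 non-zero vectors of `𝔽₉²` are the 32 multiples of `𝔽₃²`-vectors (on which `Mfun x ·`
  carries no `λ`-information we use) and 48 *free* vectors forming two regular `H`-orbits with
  representatives `wrep 0 = (1, i)`, `wrep 1 = (1, 2i)`.  The table `tab` (48 arms, keyed by
  `vcode`) records for a free `x` its orbit `O` and an exponent `e`; its correctness is exactly
  `fact_D1 : 2·Mfun (s•x) v = tabM x (s⁻¹•v)`, i.e. `2·M(s x, v) = cval e · M(wrep O, s⁻¹ v)` for
  all `s ∈ 𝔽₉ˣ`, and `M(s x, ·) = 0` for non-free `x`.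
* The **compressed λ-vector** of a matrix `r`: for each of the ten lines `𝔽₉·uvec t` of `𝔽₉²` and
  each orbit `O`, `vc r (t, O) = some e` iff `r (uvec t)` is free, in orbit `O`, with exponent `e`
  (`none` otherwise); `vz r = oval ∘ vc r ∈ ℤ[√-3]^20`.
* Decidable facts, all by compiled evaluation (`native_decide`, axiom `Lean.ofReduceBool`, the
  accepted standard for this computational family): `fact_M0`, `fact_D1`, `fact_hyper`
  (`Σ_i vz g i = 0` for invertible `g`), `fact_nz` (`vz g ≠ 0`), `fact_inv2` (adjugate inverse),
  `lineMap_bijective` (`𝔽₉² = {0} ⊔ ⨆_t 𝔽₉ˣ·uvec t`), `cross_iff` (arithmetic of `2ω^e`).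

Files II (`SubfieldCellNineLambdaDual`) and III (`SubfieldCellNineRowTwo`) build on these the
compression identity and the theorem `|Y| ≥ 2 ⇒ |Z| ≤ 17` for level-one separated pairs.
Cross-checked against the first-principles Python model `lam9.py` (gen 9, code mirror
`run/shared/lean/b2b/levelgraded-cu/code/b2b-lgcu-subfield-g9/`).
-/

set_option linter.dupNamespace false

namespace Summit.MatrixMultiplication.MatrixMultiplication.Theorems.GradedDesignFamily.Negative.SubfieldNine

open Matrix

/-- `𝔽₉ = 𝔽₃[i]` (Mathlib's computable model). -/
abbrev K : Type := QuadraticAlgebra (ZMod 3) (-1) 0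

/-- `X² + 1` is irreducible over `𝔽₃`, so `K` is a field. -/
instance instFactK : Fact (∀ r : ZMod 3, r ^ 2 ≠ -1 + 0 * r) := ⟨by decide⟩

/-- `K` is finite (via `K ≃ 𝔽₃ × 𝔽₃`). -/
instance instFintypeK : Fintype K :=
  Fintype.ofEquiv _ (QuadraticAlgebra.equivProd (-1 : ZMod 3) 0).symm

/-- `2 × 2` matrices over `𝔽₉`. -/
abbrev Mat : Type := Matrix (Fin 2) (Fin 2) K
/-- Column vectors `𝔽₉²`. -/
abbrev Vec : Type := Fin 2 → K
/-- `H = SL₂(𝔽₃)`. -/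
abbrev SL3 : Type := Matrix.SpecialLinearGroup (Fin 2) (ZMod 3)
/-- Index set of the compressed λ-vector: ten lines × two free orbits. -/
abbrev Idx : Type := Fin 10 × Fin 2

/-- The entrywise embedding `SL₂(𝔽₃) → M₂(𝔽₉)` (as matrices). -/
def phiM (h : SL3) : Mat := fun i j => ⟨(h : Matrix (Fin 2) (Fin 2) (ZMod 3)) i j, 0⟩

/-- `phiM` is the standard embedding `mapGL`, as matrices. -/
theorem phiM_eq (h : SL3) :
    phiM h = ((Matrix.SpecialLinearGroup.mapGL K h : GL (Fin 2) K) : Mat) := by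
  ext i j <;> simp [phiM, QuadraticAlgebra.algebraMap_eq]

/-- The transvection `[[1,1],[0,1]]` has determinant `1`. -/
theorem det_tU : Matrix.det !![(1 : ZMod 3), 1; 0, 1] = 1 := by
  simp [Matrix.det_fin_two_of]

/-- `t = [[1,1],[0,1]]`, a generator of `SL₂(𝔽₃)/Q₈ ≅ C₃`. -/
def tU : SL3 := ⟨!![(1 : ZMod 3), 1; 0, 1], det_tU⟩

/-- The exponent `k(h) ∈ ℤ/3` with `h ∈ t^k · Q₈` (`Q₈ = {h : h⁴ = 1}`). -/
def kexp (h : SL3) : ZMod 3 :=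
  if h ^ 4 = 1 then 0 else if (tU⁻¹ * h) ^ 4 = 1 then 1 else 2

/-- `cval k = 2·ω^k ∈ ℤ[√-3]` (`ω = (-1+√-3)/2`). -/
def cval (e : ZMod 3) : ℤ√(-3) :=
  if e = 0 then 2 else if e = 1 then ⟨-1, 1⟩ else ⟨-1, -1⟩

/-- `M(x,v) = Σ_h [h·x = v] · 2λ̄(h)` hmm: `cval (kexp h)`. -/
def Mfun (x v : Vec) : ℤ√(-3) := ∑ h : SL3, if phiM h *ᵥ x = v then cval (kexp h) else 0

/-- Code `0…8` of an element `a + b i ∈ 𝔽₉` (`a + 3b`). -/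
def kcode (y : K) : ℕ := y.re.val + 3 * y.im.val
/-- Code `0…80` of a vector of `𝔽₉²`. -/
def vcode (x : Vec) : ℕ := 9 * kcode (x 0) + kcode (x 1)

/-- Free-orbit table: vector code ↦ (free `H`-orbit, exponent `e`) with `2·M(x,·) = cval e · M(w_O,·)`. -/
def tabN : ℕ → Option (Fin 2 × ZMod 3)
  | 12 => some (0, 0) | 13 => some (0, 1) | 14 => some (0, 2) | 15 => some (1, 0)
  | 16 => some (1, 1) | 17 => some (1, 2) | 21 => some (1, 0) | 22 => some (1, 2)
  | 23 => some (1, 1) | 24 => some (0, 0) | 25 => some (0, 2) | 26 => some (0, 1)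
  | 28 => some (1, 0) | 29 => some (0, 0) | 31 => some (1, 1) | 32 => some (0, 1)
  | 34 => some (1, 2) | 35 => some (0, 2) | 37 => some (1, 2) | 38 => some (0, 1)
  | 39 => some (0, 2) | 41 => some (1, 0) | 42 => some (1, 1) | 43 => some (0, 0)
  | 46 => some (1, 1) | 47 => some (0, 2) | 48 => some (1, 2) | 49 => some (0, 0)
  | 51 => some (0, 1) | 53 => some (1, 0) | 55 => some (0, 0) | 56 => some (1, 0)
  | 58 => some (0, 2) | 59 => some (1, 2) | 61 => some (0, 1) | 62 => some (1, 1)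
  | 64 => some (0, 2) | 65 => some (1, 1) | 66 => some (0, 1) | 67 => some (1, 0)
  | 69 => some (1, 2) | 71 => some (0, 0) | 73 => some (0, 1) | 74 => some (1, 2)
  | 75 => some (1, 1) | 77 => some (0, 0) | 78 => some (0, 2) | 79 => some (1, 0)
  | _ => none

/-- Orbit/exponent table of free vectors (`none` on non-free vectors); see `fact_D1`. -/
def tab (x : Vec) : Option (Fin 2 × ZMod 3) := tabN (vcode x)

/-- Representatives of the two free `H`-orbits on `𝔽₉² ∖ 0`: `(1, i)` and `(1, 2i)`. -/
def wrep (O : Fin 2) : Vec := if O = 0 then ![⟨1, 0⟩, ⟨0, 1⟩] else ![⟨1, 0⟩, ⟨0, 2⟩]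

/-- Inverse of `kcode`. -/
def ofCode (n : ℕ) : K := ⟨((n % 3 : ℕ) : ZMod 3), ((n / 3 : ℕ) : ZMod 3)⟩

/-- Representatives of the ten lines of `𝔽₉²`: `u_t = (1, t)` (`t` = the element of code `t < 9`), `u_9 = (0,1)`. -/
def uvec (t : Fin 10) : Vec := if t.val < 9 then ![1, ofCode t.val] else ![0, 1]

/-- Right-hand side of the table identity `fact_D1`. -/
def tabM (x v : Vec) : ℤ√(-3) :=
  match tab x with
  | none => 0
  | some (O, e) => cval e * Mfun (wrep O) v

/-- Explicit `2 × 2` matrix–vector product (fast evaluation). -/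
def mv2 (r : Mat) (x : Vec) : Vec := ![r 0 0 * x 0 + r 0 1 * x 1, r 1 0 * x 0 + r 1 1 * x 1]

/-- `mv2` is `Matrix.mulVec`. -/
theorem mv2_eq (r : Mat) (x : Vec) : mv2 r x = r *ᵥ x := by
  funext i; fin_cases i <;> simp [mv2, Matrix.mulVec, dotProduct, Fin.sum_univ_two]

/-- Explicit `2 × 2` matrix product (fast evaluation). -/
def mul2 (a b : Mat) : Mat :=
  !![a 0 0 * b 0 0 + a 0 1 * b 1 0, a 0 0 * b 0 1 + a 0 1 * b 1 1;
     a 1 0 * b 0 0 + a 1 1 * b 1 0, a 1 0 * b 0 1 + a 1 1 * b 1 1]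

/-- `mul2` is matrix multiplication. -/
theorem mul2_eq (a b : Mat) : mul2 a b = a * b := by
  refine Matrix.ext fun i j => ?_
  fin_cases i <;> fin_cases j <;> simp [mul2, Matrix.mul_apply, Fin.sum_univ_two]

/-- Explicit `2 × 2` determinant. -/
def det2 (a : Mat) : K := a 0 0 * a 1 1 - a 0 1 * a 1 0

/-- `det2` is `Matrix.det`. -/
theorem det2_eq (a : Mat) : det2 a = a.det := by
  rw [Matrix.det_fin_two]; rfl

/-- Explicit inverse of an invertible `2 × 2` matrix over `𝔽₉` (`det⁻¹ = det⁷`). -/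
def inv2 (a : Mat) : Mat :=
  !![det2 a ^ 7 * a 1 1, -(det2 a ^ 7 * a 0 1); -(det2 a ^ 7 * a 1 0), det2 a ^ 7 * a 0 0]

/-- The λ-code vector of a matrix: `vc r (t,O) = some e` iff `r u_t` is in free orbit `O` with exponent `e`. -/
def vc (r : Mat) (i : Idx) : Option (ZMod 3) :=
  match tab (mv2 r (uvec i.1)) with
  | none => none
  | some (O, e) => if O = i.2 then some e else none

/-- Value `2ω^e` of an exponent code (`0` for `none`). -/
def oval : Option (ZMod 3) → ℤ√(-3)
  | none => 0
  | some e => cval e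

/-- The compressed λ-vector of a matrix, with values in `ℤ[√-3]`. -/
def vz (r : Mat) (i : Idx) : ℤ√(-3) := oval (vc r i)

/-! ### Decidable facts (compiled evaluation) -/

/-- `M(0, ·) = 0`. -/
theorem fact_M0 : ∀ v : Vec, Mfun 0 v = 0 := by native_decide

/-- **Table identity.** `2·M(s•x, v) = tabM x (s⁻¹•v)`: correctness of `tab`. -/
theorem fact_D1 : ∀ x : Vec, ∀ s : Kˣ, ∀ v : Vec, 2 * Mfun (s • x) v = tabM x (s⁻¹ • v) := by
  native_decide

/-- The coordinates of the λ-vector of an invertible matrix sum to zero. -/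
theorem fact_hyper : ∀ r : Mat, det2 r ≠ 0 → ∑ i : Idx, vz r i = 0 := by native_decide

/-- The λ-vector of an invertible matrix is non-zero. -/
theorem fact_nz : ∀ r : Mat, det2 r ≠ 0 → ∃ i : Idx, vz r i ≠ 0 := by native_decide

/-- `inv2 a` is a left inverse of an invertible `a`. -/
theorem fact_inv2 : ∀ a : Mat, det2 a ≠ 0 → inv2 a * a = 1 := by native_decide

/-- Parametrisation of `𝔽₉²` by `{0} ⊔ ⨆_t 𝔽₉ˣ · uvec t`. -/
def lineMap : Option (Kˣ × Fin 10) → Vec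
  | none => 0
  | some (s, t) => s • uvec t

/-- `lineMap` is a bijection. -/
theorem lineMap_bijective : Function.Bijective lineMap := by native_decide

/-- `k(1) = 0`. -/
theorem kexp_one : kexp 1 = 0 := by decide

/-- Cross-multiplication in `ℤ[√-3]`: `oval p · 2ω^{e₀} = 2ω^{e₁} · oval q ↔ p = q.map (· + (e₁ - e₀))` (exhaustive check). -/
theorem cross_iff : ∀ (p q : Option (ZMod 3)) (e₀ e₁ : ZMod 3),
    oval p * cval e₀ = cval e₁ * oval q ↔ p = q.map (· + (e₁ - e₀)) := by decide

end Summit.MatrixMultiplication.MatrixMultiplication.Theorems.GradedDesignFamily.Negative.SubfieldNine
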